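import Summits.ResolutionOfSingularities.ResolutionOfSingularities.Theorems.FrobeniusClosingSteerGeoDictResiduePRank
import Summits.ResolutionOfSingularities.ResolutionOfSingularities.Theorems.FrobeniusClosingSteerSteeredExit
import Summits.ResolutionOfSingularities.ResolutionOfSingularities.Theorems.FrobeniusClosingSteerMemberDimension
import Literature.AlgebraicGeometry.Resolution.DimensionInequalityTrdeg
import HarnessLib

/-!
# Crux `Steer` (stmt-ResolutionOfSingularities-16345), chain W4.1, p = 2 σ-residual, HIGH half, `ThreadWanderTwoN` —
# brick Θ2: the height of a prime does not grow up a tower of local blowings up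

OURS (campaign `res-hironaka`, rung L ★L-G4, slot W4.1; seat res-type-096 g8; BRICK WANTED by res-D-pv-011 AS
res-L0-w41-stub-7, 2026-08-27T08:56:37Z, for its Θ3 leaf of `ThreadWanderTwoN`; replaces the role of no printed item; NOT a statement of
the manuscript under review; AI-produced, weaker than expert review).

* `TowerHeight.height_le_height_comap_of_tower` — for a tower `R 0 = (A₀)_{𝔪_O ∩ A₀} → R 1 → ⋯` of local blowings up along a
  valuation ring `O` of `K = Frac k[A₀, t]` (`t^p ∈ A₀`, `A₀` finitely generated), `i ≤ m`, `R i ≤ R m` and a prime `Q` of `R m`: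
  `ht Q ≤ ht (Q ∩ R i)`. Route (all bricks in the tree): finitely generated MODELS `A_i ≤ A_m` with `(A_l)_{𝔪_O ∩ A_l} = R l`
  (`SteeredExit.exists_model_of_tower`, at `0 → i` and re-based `i → m`), `ht Q = ht (Q ∩ A_m)` and `ht (Q ∩ R i) = ht (Q ∩ A_i)`
  (`GeoDict.height_comap_model_eq_of_locChar` over `GeoDict.exists_locChar`), and the dimension inequality
  `ht 𝔔 ≤ ht 𝔮 + tr.deg_{A_i} A_m` (Matsumura 15.5, tree `height_le_height_add_trdeg`) with `tr.deg_{A_i} A_m = 0`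
  (`TailCodim.isAlgebraic_of_adjoin_isFractionRing`). The fraction-field binder is the `CoreDatum` form
  `IsFractionRing (Algebra.adjoin k (insert t A₀)) K`.

[cite: Matsumura1987, Thm. 15.5] [cite: NovacoskiSpivakovsky2014, Def. 2.11] [folklore]
-/

noncomputable section

-- `Summit.<S>.<S>.…` duplicates the summit name by design (single-problem summit).
set_option linter.dupNamespace false

open IsLocalRing

namespace Summit.ResolutionOfSingularities.ResolutionOfSingularities.Theorems.SwitchingDichotomy

namespace TowerHeight

open Literature.AlgebraicGeometry.Resolution

variable {k K : Type} [Field k] [Field K] [Algebra k K]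

/-- **Heights along finitely generated models**: for finitely generated `k`-subalgebras `A₁ ≤ A₂ ⊆ K` with `A₂` ALGEBRAIC over `A₁`
and primes `𝔔₂ ⊆ A₂` over `𝔔₁ = 𝔔₂ ∩ A₁`: `ht 𝔔₂ ≤ ht 𝔔₁` (Matsumura's dimension inequality with `tr.deg_{A₁} A₂ = 0`).
[cite: Matsumura1987, Thm. 15.5] [folklore] -/
theorem height_comap_le_of_isAlgebraic (A₁ A₂ : Subalgebra k K) (h12 : A₁ ≤ A₂) (hfg₁ : A₁.FG) (hfg₂ : A₂.FG)
    (halg : Algebra.IsAlgebraic A₁ K) (𝔔 : Ideal A₂) [𝔔.IsPrime] :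
    𝔔.height ≤ (𝔔.comap (Subalgebra.inclusion h12).toRingHom).height := by
  letI alg : Algebra A₁ A₂ := (Subalgebra.inclusion h12).toRingHom.toAlgebra
  haveI : IsScalarTower k A₁ A₂ := IsScalarTower.of_algebraMap_eq fun x => rfl
  haveI : Algebra.FiniteType k A₁ := A₁.fg_iff_finiteType.mp hfg₁
  haveI : Algebra.FiniteType k A₂ := A₂.fg_iff_finiteType.mp hfg₂
  haveI : IsNoetherianRing A₁ := Algebra.FiniteType.isNoetherianRing k A₁
  haveI : Algebra.FiniteType A₁ A₂ := Algebra.FiniteType.of_restrictScalars_finiteType k A₁ A₂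
  haveI : FaithfulSMul A₁ A₂ :=
    (faithfulSMul_iff_algebraMap_injective A₁ A₂).mpr (Subalgebra.inclusion_injective h12)
  -- `A₂` is algebraic over `A₁` (inside the algebraic extension `K`)
  haveI : IsScalarTower A₁ A₂ K := IsScalarTower.of_algebraMap_eq fun x => rfl
  haveI : Algebra.IsAlgebraic A₁ A₂ :=
    Algebra.IsAlgebraic.of_injective (IsScalarTower.toAlgHom A₁ A₂ K) Subtype.val_injective
  haveI : (𝔔.LiesOver (𝔔.comap (Subalgebra.inclusion h12).toRingHom)) := ⟨rfl⟩
  have h := height_le_height_add_trdeg (𝔔.comap (Subalgebra.inclusion h12).toRingHom) 𝔔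
  rwa [trdeg_eq_zero (R := A₁) (A := A₂), map_zero, Nat.cast_zero, add_zero] at h

/-- **Θ2 · height does not grow up the tower.** Let `A₀ ⊆ O` be a finitely generated `k`-subalgebra of `K = Frac k[A₀, t]`
(`t^p ∈ A₀`, `p ≥ 1`), `R 0 = (A₀)_{𝔪_O ∩ A₀}`, and `R (j+1)` a local blowing up of `R j` with respect to `O` for every `j`. For
`i ≤ m` with `R i ≤ R m` and a prime `Q` of `R m`: `ht Q ≤ ht (Q ∩ R i)`. [cite: Matsumura1987, Thm. 15.5]
[cite: NovacoskiSpivakovsky2014, Def. 2.11] [folklore] -/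
theorem height_le_height_comap_of_tower (O : ValuationSubring K) (A₀ : Subalgebra k K) (h₀ : A₀.toSubring ≤ O.toSubring)
    (hfg : A₀.FG) (t : K) (p : ℕ) (hp : 0 < p) (htp : t ^ p ∈ A₀)
    (hfr : IsFractionRing (Algebra.adjoin k (insert t (A₀ : Set K))) K)
    (R : ℕ → Subring K) (hR0 : R 0 = locAtCentre A₀.toSubring O) (hstep : ∀ j, IsLocalBlowup O (R j) (R (j + 1)))
    {i m : ℕ} (him : i ≤ m) (hle : R i ≤ R m) (Q : Ideal (R m)) [Q.IsPrime] :
    Q.height ≤ (Q.comap (Subring.inclusion hle)).height := by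
  classical
  obtain ⟨j, rfl⟩ := Nat.exists_eq_add_of_le him
  -- models `A₁` of `R i` and `A₂ ⊇ A₁` of `R (i + j)`
  obtain ⟨A₁, hA₁O, h01, hfg₁, hR₁⟩ :=
    SteeredExit.exists_model_of_tower O A₀ h₀ hfg hR0 (N := i) fun l _ => hstep l
  obtain ⟨A₂, hA₂O, h12, hfg₂, hR₂⟩ :=
    SteeredExit.exists_model_of_tower O A₁ hA₁O hfg₁ (R := fun l => R (i + l)) (N := j) hR₁.symm
      fun l _ => by simpa [Nat.add_assoc] using hstep (i + l)
  -- the traces of `Q` and of `q = Q ∩ R i` on the models have the same heights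
  set q : Ideal (R i) := Q.comap (Subring.inclusion hle) with hq
  obtain ⟨T, hT⟩ := GeoDict.exists_locChar (R (i + j)) Q
  obtain ⟨T', hT'⟩ := GeoDict.exists_locChar (R i) q
  have hQ : (Q.comap (Subring.inclusion (GeoDict.model_le_of_locAtCentre_eq O A₂ hR₂))).height = Q.height :=
    GeoDict.height_comap_model_eq_of_locChar O A₂ hR₂ hT
  have hq' : (q.comap (Subring.inclusion (GeoDict.model_le_of_locAtCentre_eq O A₁ hR₁))).height = q.height :=
    GeoDict.height_comap_model_eq_of_locChar O A₁ hR₁ hT'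
  -- the trace of `Q` on `A₂`, pulled back to `A₁`, is the trace of `q` on `A₁`
  set 𝔔 : Ideal A₂ := Q.comap (Subring.inclusion (GeoDict.model_le_of_locAtCentre_eq O A₂ hR₂)) with h𝔔
  haveI : 𝔔.IsPrime := Ideal.comap_isPrime _ _
  have hcomap : 𝔔.comap (Subalgebra.inclusion h12).toRingHom =
      q.comap (Subring.inclusion (GeoDict.model_le_of_locAtCentre_eq O A₁ hR₁)) := by
    ext x
    simp only [h𝔔, hq, Ideal.mem_comap]
    constructor <;> intro hx <;> exact hx
  have halg : Algebra.IsAlgebraic A₁ K :=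
    TailCodim.isAlgebraic_of_adjoin_isFractionRing A₀ A₁ h01 hp htp hfr
  have h := height_comap_le_of_isAlgebraic A₁ A₂ h12 hfg₁ hfg₂ halg 𝔔
  rw [hcomap, hq'] at h
  rw [← hQ]
  exact h

end TowerHeight

end Summit.ResolutionOfSingularities.ResolutionOfSingularities.Theorems.SwitchingDichotomy

end
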